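import Literature.IUT.HodgeArakelov.ThetaEnvDataRecordAutSaturatedOfKummer
import Literature.IUT.HodgeArakelov.EtaleThetaDataOfSettingAutActionKummerOfGalois

/-!
# [IUTchII] Prop 3.4 (i) at the GENUINE data — statement of record of DAG node IUTchII:Prop3.4(i):
# saturated index set, genuine constants `ℚ̄_pˣ ⊇ 𝒪^▷`, genuine Kummer map; residual = {F-0620, `hq`, `hroot`, `hgal`}

S. Mochizuki, *Inter-universal Teichmüller theory II*, kurims manuscript (Dec. 2020): Prop 3.4 (i) pp. 91–92
(«the left-hand square in each diagram arises from the functoriality of the algorithms involved»)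
[cite: Mochizuki2012, Prop 3.4 (i) p.91]; Prop 3.1 (i) p. 87, (ii) p. 88; Prop 1.4 p. 27; Cor 1.11 (a), (b) p. 49.
Claim key DISPUTED (D-0012).  Refereed inputs BY NAME: [EtTh] Cor. 2.18 (i) p. 60 (= FACT F-0620 `RigidData.Cor218_i`),
Cor. 2.19 (i) p. 64, (iii) p. 65; [AbsTopIII] Cor. 1.10 p. 46, Prop. 3.2 p. 71.  abc-iut cell, layer L6, WAVE-5 seat
abc-iut-w5-d169 (gen 4; holder of `plan/L6/SUBDAG-IUTchII-Prop-31-33-34.md`, node IUTchII:Prop3.4(i)); GAP-LEDGER rows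
G-w5d169-2 (`hroot`), G-w5d169-3 (reduced to `hgal` by abc-iut-w4-d007, D-row 09:30:58Z).

PROOF-ONLY assembly (no definition, no `Prop`-valued fact, nothing restated).  abc-iut-w5-d169 gen 3's
`EtaleLevels.prop34i_multiradiallyDefined_saturated_ofKummer` (p433888: abc-iut-w6-d002's saturated index set p432926,
(P4) ⟸ `hroot`, (P3) ⟸ `hsemi` at a generic constant monoid) is SPECIALISED to the genuine constants `A = ℚ̄_pˣ` with
`Π^tp_X̲̲` acting through `ε = aug C` (abc-iut-w4-d007's `unitsAction`), any `G_{ℚ_p}`-stable submonoid `O` (`𝒪^▷`,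
`𝒪^×`) and cyclotome-tower coefficients `c` (`red_M (c ζ) = ζ_M`), where abc-iut-w4-d007's `hsemi_units_of_galois`
(p434937) supplies `hsemi` from
`hgal : ∀ α ∈ Aut_top(Π^tp_X̲̲), ∃ τ ∈ G_{ℚ_p}, (HGAL) ε ∘ α = Inn(τ) ∘ ε ∧ (HCYC) red_M ∘ ᾱ = τ ∘ red_M on l·Δ_Θ (∀ M)`
([AbsTopIII] Cor. 1.10, Galois side; [IUTchII] Cor. 1.11 (b) / [EtTh] Cor. 2.19 (i), cyclotomic-rigidity side — both
THEOREMS for inner `α`, abc-iut-w4-d007's `hgal_of_inner`).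
* **`EtaleLevels.prop34i_multiradiallyDefined_saturated_ofGalois`** — [IUTchII] Prop 3.4 (i) MULTIRADIALITY OF SPLIT
  THETA MONOIDS AT THE GENUINE FUNCTOR; residual BY NAME exactly: F-0620 (FACT, `h218i` at `R = C.rigidData …`) ·
  `hq` (origin clause R3 of [EtTh] §1, `ThetaSetting.IsThm16Origin.isQuotientMap_toTheta`) · `hroot` (G-w5d169-2:
  [EtTh] Cor. 2.19 (iii) read at `H¹(Π^tp_Ÿ̲̲, l·Δ_Θ)`; kernel reductions by abc-iut-w4-d041 p436508
  `rootHyp_of_forall_companion_delta` and abc-iut-w6-d004) · `hgal` (G-w5d169-3 reduced) · the origin guard `hO'` ·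
  the standing record / tower inputs (`mods`, `hmods`, `h15`, `L`, `hZ`, `hcharY`, `hlim`, `τw`, `c`, `hlev`).
* **`EtaleLevels.exists_coeff_prop34i_multiradiallyDefined_saturated_ofGalois`** — the same with the coefficient datum
  `c`/`hlev` DISCHARGED (abc-iut-w4-d007's `exists_cyclotomeCoefficients_of_cyclotomeTower`: under the origin guard
  and compactness of `Δ_Θ` a bijective `c : Λ(ℚ̄_pˣ) ⥲ l·Δ_Θ` inverse to the tower EXISTS).
Nothing here asserts anything of [IUTchII]; no side taken on [IUTchIII] Cor 3.12; typed ≠ proved for the binders.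
-/

noncomputable section

open Topology

namespace Literature.IUT.HodgeArakelov

open Literature.AnabelianGeometry.EtaleTheta Literature.AnabelianGeometry.SemiGraphs
open CohomologySystemOfContH1 EtaleThetaDataOfSetting TemperedThetaMonoids
open scoped Literature.AnabelianGeometry.EtaleTheta

namespace EtaleLevels

variable {p : ℕ} [Fact p.Prime] {D : Literature.AnabelianGeometry.EtaleTheta.ThetaSetting p}
  {E : D.EtaleThetaData} {l : ℕ} (C : E.DoubleUnderline l) (hC : D.Compat) (hS : D.Sec2Hyps)
  (hl : l.Prime) (hp2 : p ≠ 2) (hpl : p ≠ l) (hζ : ∃ ζ : D.K, IsPrimitiveRoot ζ (4 * l))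
  (mods : ∀ M : ℕ+, D.CyclotomeMod l M)
  (f : contCocycles D.toTheta D.DeltaTheta C.GtpYdduu) (hf : f ∈ C.rootCocycles hC)
  (hmods : ∀ (M M' : ℕ+) (h : (M : ℕ) ∣ (M' : ℕ)) (x : D.lDeltaTheta l),
    MuN.red p M M' h ((mods M').red x) = (mods M).red x)
  (h15 : Literature.AnabelianGeometry.EtaleTheta.ThetaSetting.Prop15iii E hC) (L : C.CuspLabels)
  (hZ : ∀ M : ℕ+, Nonempty (ModelCyclotomes.lDeltaQuot (C.rigidData (mods M) hC hS h15 L) ≃*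
    Literature.IUT.HodgeTheaters.ZHat))
  (hcharY : EtaleThetaDataOfSetting.PiYddCharacteristic C)
  (hlim : Function.Bijective (rigidLimHom C hC hS hl hp2 hpl hζ mods f hf hmods h15 L hZ))
  [(EtaleThetaDataOfSetting.PiYdd C).Normal]
  (hq : IsQuotientMap D.toTheta) {N : ℕ+} (μ : D.CyclotomeMod l N)
  (R : RigidData.{0} N l) (hR : R = C.rigidData μ hC hS h15 L) (h218i : R.Cor218_i)
  (hroot : ∀ α : (Pi C) ≃ₜ* (Pi C), ∃ τ : Pi C, ∃ ε : (coh C).H1 ⊤, l • ε = 0 ∧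
    autActTopOfCor218i C hq μ hC hS h15 L R hR h218i α (rootTop C) =
      h1TopConjEquiv (phi C) (D.lDeltaTheta l) (PiYdd C) τ (rootTop C) + ε)
  (ι₀ : (Pi C) ≃ₜ* (Pi C))
  {Es : Set ℕ+} (τw : D.CyclotomeTower l Es)
  (O : Submonoid (PadicAlgCl p)ˣ)
  (hO : ∀ (σ : GQp p) (u : (PadicAlgCl p)ˣ), u ∈ O → Units.map (σ : PadicAlgCl p →* PadicAlgCl p) u ∈ O)
  (hO' : D.IsEtThOrigin)
  (hgal : ∀ α : (Pi C) ≃ₜ* (Pi C), ∃ τ : GQp p,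
    (∀ x : Pi C, aug C (α x) = τ * aug C x * τ⁻¹) ∧
    (∀ (M : ℕ+) (z w : D.lDeltaTheta l),
      ((rangeAutOfCor218i C μ hq hC hS h15 L R hR h218i α
          ⟨(z : D.GtpTheta), lDeltaTheta_le_phiRange C z.2⟩ : phiRange C) : D.GtpTheta) = (w : D.GtpTheta) →
        (τw.modAll M).red w = galMuN p M τ ((τw.modAll M).red z)))

/-- **[IUTchII] Prop 3.4 (i) — MULTIRADIALITY OF SPLIT THETA MONOIDS AT THE GENUINE FUNCTOR (statement of record of
node IUTchII:Prop3.4(i))**: `ι` over the `Aut_top(Π^tp_X̲̲)`-SATURATED orbit of `ρ_{ι₀}` (abc-iut-w6-d002), constants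
`ℚ̄_pˣ ⊇ O` through `ε`, genuine Kummer map `κ = h1LimKummerOn c O` (abc-iut-w4-d007); binders (P1) := {F-0620, `hq`},
(P2) none, (P3) := `hgal` = (HGAL) ∧ (HCYC), (P4) := `hroot`. [cite: Mochizuki2012, Prop 3.4 (i) p.92] -/
theorem prop34i_multiradiallyDefined_saturated_ofGalois
    (c : CyclotomeCoefficients (phi C) (D.lDeltaTheta l) (PadicAlgCl p)ˣ)
    (hlev : ∀ (ζ : cyclotome (PadicAlgCl p)ˣ) (M : ℕ+),
      (((τw.modAll M).red (c.hom ζ) : MuN p M) : (PadicAlgCl p)ˣ) = (ζ : ℕ+ → (PadicAlgCl p)ˣ) M)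
    {η : (C.thetaEnvData μ hC hS).PiYdd → MuN p N} (hη : η ∈ (C.thetaEnvData μ hC hS).thetaCocycles)
    (Γ : Type) [Group Γ] :
    ((ex18iii (ThetaSetting.ofDoubleUnderline C μ hC hS hl hp2 hpl hζ hη) Γ).toDagger
      (TemperedThetaMonoids.prop34iRadialFunctor
        (thetaEnvTransportS C hC hS hl hp2 hpl hζ mods f hf hmods h15 L hZ hcharY hlim hq μ R hR h218i
          (h1LimKummerOn (phi C) (D.lDeltaTheta l) (PiYdd C) c (isOpen_stabilizer_units C)
            (finiteIndex_stabilizer_units C) O) ι₀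
          (map_mrange_h1LimKummerOn_eq_of_galois C hq μ τw c hlev O hO hC hS h15 L R hR h218i hO' hgal)
          (image_toLim_theta_thetaEnvData_of_rootHyp C hC hS hl hp2 hpl hζ mods f hf hmods h15 L hZ hcharY hlim hq
            μ R hR h218i hroot)
          (image_thetaInfty_thetaEnvData_of_rootHyp C hC hS hl hp2 hpl hζ mods f hf hmods h15 L hZ hcharY hlim hq μ
            R hR h218i hroot) hη)
        Γ)).IsMultiradiallyDefined :=
  prop34i_multiradiallyDefined_saturated_ofKummer C hC hS hl hp2 hpl hζ mods f hf hmods h15 L hZ hcharY hlim hq μ R hR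
    h218i hroot ι₀ c (isOpen_stabilizer_units C) (finiteIndex_stabilizer_units C) O
    (hsemi_units_of_galois C hq μ τw c hlev O hO hC hS h15 L R hR h218i hO' hgal) hη Γ

/-- **The same with the coefficient datum DISCHARGED**: under the origin guard and compactness of `Δ_Θ` there IS a
bijective change of coefficient cyclotome `c : Λ(ℚ̄_pˣ) ⥲ l·Δ_Θ` inverse to the tower's identifications
(`red_M (c ζ) = ζ_M`, abc-iut-w4-d007's `exists_cyclotomeCoefficients_of_cyclotomeTower`) for which [IUTchII]
Prop 3.4 (i) multiradiality holds at the genuine functor with Kummer map `h1LimKummerOn c O` — residual BY NAME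
{F-0620, `hq`, `hroot`, `hgal`, `hO'`, `hΔ`} plus the standing record/tower inputs. [cite: Mochizuki2012, Prop 3.4 (i) p.92] -/
theorem exists_coeff_prop34i_multiradiallyDefined_saturated_ofGalois
    (hΔ : IsCompact (D.DeltaTheta : Set D.GtpTheta))
    {η : (C.thetaEnvData μ hC hS).PiYdd → MuN p N} (hη : η ∈ (C.thetaEnvData μ hC hS).thetaCocycles)
    (Γ : Type) [Group Γ] :
    ∃ (c : CyclotomeCoefficients (phi C) (D.lDeltaTheta l) (PadicAlgCl p)ˣ)
      (hlev : ∀ (ζ : cyclotome (PadicAlgCl p)ˣ) (M : ℕ+),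
        (((τw.modAll M).red (c.hom ζ) : MuN p M) : (PadicAlgCl p)ˣ) = (ζ : ℕ+ → (PadicAlgCl p)ˣ) M),
      Function.Bijective c.hom ∧
      ((ex18iii (ThetaSetting.ofDoubleUnderline C μ hC hS hl hp2 hpl hζ hη) Γ).toDagger
        (TemperedThetaMonoids.prop34iRadialFunctor
          (thetaEnvTransportS C hC hS hl hp2 hpl hζ mods f hf hmods h15 L hZ hcharY hlim hq μ R hR h218i
            (h1LimKummerOn (phi C) (D.lDeltaTheta l) (PiYdd C) c (isOpen_stabilizer_units C)
              (finiteIndex_stabilizer_units C) O) ι₀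
            (map_mrange_h1LimKummerOn_eq_of_galois C hq μ τw c hlev O hO hC hS h15 L R hR h218i hO' hgal)
            (image_toLim_theta_thetaEnvData_of_rootHyp C hC hS hl hp2 hpl hζ mods f hf hmods h15 L hZ hcharY hlim hq
              μ R hR h218i hroot)
            (image_thetaInfty_thetaEnvData_of_rootHyp C hC hS hl hp2 hpl hζ mods f hf hmods h15 L hZ hcharY hlim hq
              μ R hR h218i hroot) hη)
          Γ)).IsMultiradiallyDefined := by
  obtain ⟨c, hc, hlev⟩ := exists_cyclotomeCoefficients_of_cyclotomeTower C hO' hΔ τw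
  exact ⟨c, hlev, hc, prop34i_multiradiallyDefined_saturated_ofGalois C hC hS hl hp2 hpl hζ mods f hf hmods h15 L hZ
    hcharY hlim hq μ R hR h218i hroot ι₀ τw O hO hO' hgal c hlev hη Γ⟩

end EtaleLevels

end Literature.IUT.HodgeArakelov

end
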